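import Summits.Ventures.QEC.Census.BB.BB72.KernelZ
import HarnessLib

/-!
# `BB72` — the certified `Z`-distance: `d_Z = 6`, tier KERNEL (emitted/assembled by qec-search-7)

The bivariate-bicycle code `[[72,12,6]]` of Bravyi–Cross–Gambetta–Maslov–Rall–Yoder (Nature 627 (2024); a CLAIM
as printed) enters the tree as the explicit CSS code `cert.code _` of the distance certificate
`Census/BB/BB72/Cert.lean` (certificate id `7e943c5a566adc43`, kernel A; certB `1e757ed06e233576` agrees; ref-1
ROW-SIGNED): qubits `Fin 72`, check matrices `rowMatrix 72 cert.HX`, `rowMatrix 72 cert.HZ` (type-02's `CSSCode`,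
`Literature/InformationTheory/QuantumCodes/CSS.lean`).

* the structural part of type-10's checker (commutation, upper witnesses, allow-lists) by `decide +kernel` (inline;
  the named copy is `BB72.structure_ok'` in the route's Theorems file);
* **`dZ_eq : (cert.code _).dZ = 6`** — from the upper witness (`CertCheck.upper_sound`: a weight-6 `Z`-logical with
  a non-membership witness) and the KERNEL-tier bruteforce replay `KernelZ.reachesZ` (every `Z`-type operator of
  weight `≤ 5` has nonzero syndrome; 10 leaf files `KernelZ01 … KernelZ10`, 94 chunk evaluations, `1.5 · 10⁷` supports)
  through `CertCheck.lower_sound` and type-02's certificate lemma `CSSCode.dZ_eq_of_witness`.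

Tier KERNEL = CERTIFIED: axioms ⊆ {propext, Classical.choice, Quot.sound} (no `native_decide` anywhere in the import
closure of this file; the COMPILED-tier twin is `BB72/CertNative.lean`). `d_X = 6`, `k = 12` and the discharge of
type-05's CLAIM `BB72_12_6_claim` over `BB.bb72` follow in appended sections / sibling files.
-/

namespace Summit.Ventures.QEC.Census.BB72

open Matrix Literature.InformationTheory.QuantumCodes

/-- The commutation check of the `BB72` certificate (names the CSS code `cert.code commOK_cert`); from the structural
check `cert.checkStructure` (= `BB72.structure_ok'` of the route file, re-evaluated here by `decide +kernel` to keep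
this census file free of route imports). -/
theorem commOK_cert : commOK cert.n cert.HX cert.HZ = true :=
  cert.commOK_of_checkStructure (by decide +kernel)

/-- **`d_Z = 6` for the `[[72,12,6]]` bivariate-bicycle code, CERTIFIED** (tier KERNEL): the CSS code over `Fin 72`
with check matrices `rowMatrix 72 cert.HX`, `rowMatrix 72 cert.HZ` has `Z`-distance exactly `6` — upper bound by the
explicit weight-6 `Z`-logical of the certificate, lower bound by the kernel-replayed enumeration of all `1.5 · 10⁷`
`Z`-type operators of weight `≤ 5` (`KernelZ.reachesZ`). -/
theorem dZ_eq : (cert.code commOK_cert).dZ = 6 := by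
  have hs : cert.checkStructure = true := by decide +kernel
  simp only [DistCert.checkStructure, Bool.and_eq_true] at hs
  obtain ⟨hv, hv', hwt⟩ := upper_sound hs.1.1.1.2
  have hd : cert.sideZ.d = 6 := rfl
  rw [hd] at hwt
  refine (cert.code commOK_cert).dZ_eq_of_witness hv hv' hwt fun w hw hw' => ?_
  have hlow := lower_sound (n := cert.n) (Hsyn := cert.HX) (Hstab := cert.HZ) (found := cert.sideZ.found)
    hs.1.1.2 reachesZ w hw hw'
  omega

end Summit.Ventures.QEC.Census.BB72
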